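import Summits.HodgeConjecture.HodgeConjecture.Theorems.F0P3SpectralPacketHomogeneous   -- ★ (N) FILE 3w: `HomogPacketG`, `XiPacketsSignedHom`, `piXiHm`, (L1″) `XiRigidityGHom` (+ ★ 3v∕3q `IsSignedPacketOf`, ★ 3f `evpGψ`, ★ 3a `SpectralPacketG`, ★ 2 `GlobalPacket`, ★ 1 `LocalPacketKit`)
import HarnessLib

/-!
# (PK-A-G) RIGIDITY REDUCED — `XiRigidityGHom` FROM THE MARKER LAWS (KM1)∕(KJ-G)∕(KM2)∕(KM3) AND TWO MEMBER FACTS («`πⁿ(ξ_v) ∈ Q_v` at one place» for all-L `Q`;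
# «`Q_v` meets `Π(ξ_v)` at every place» for all-A `Q`) — kit-generic; plus extensionality of `GlobalPacket`∕`SpectralPacketG`

Cell `hodgecm-mathlib`, F0∕P3c line LH7 (closer stub `stub_PKtuple : PKtupleLetter`, `Cruxes/H413/Lines/F0_U3LettersRung1.lean` ED. 38 «PK-ε», row #181),
crux H413 = `stmt-HodgeConjecture-24833`; organ payer LH7-p03 (g0), DEFAULT organ «RIGID-RED» (censuses `F0/P3c/LH7/LH7-p02/g0/CENSUS-PKtuple-inhouse.v1.md` ec8ac256ebd4be69
§3 row (PK-A-G) + §4 «(KM1)(KM2)(KM3)(KJ-G) UNREAD by T-B … were LETTER 2's inputs»; `F0/P3c/LH7/LH7-p01/g0/CENSUS-PKtuple-print.v1.1.md` f3ec0ab23d6c1399 row A-G).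
`--supports stmt-HodgeConjecture-24833`; closes no stub.

THE MATHEMATICS [Rogawski1990 §13.3 Thm. 13.3.5, Thm. 13.3.6 (c) p. 202; §13.1 p. 199 ¶2; §13.2 p. 200 l. 1–3].  (L1″) `XiRigidityGHom h ψ νG tXi` (★ 3w) says: a discrete `G`-packet `Q`
with coherent archimedean coordinate and finite part OF ONE SORT (all tokens A-tokens, or none), whose e.v.p. agrees with `t(ξ)` off a finite `S ⊇ ramG Q`, IS `Π(ξ) := (piXiHm h ξ).1`.
Print's proof has three layers, and this file separates them:
1. BOOKKEEPING (§1–§2, proved here): a spectral packet is determined by its finite tokens once the archimedean coordinate is coherent (`Q.inf = infOf Q.fin`); two A-tokens that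
   both carry the signed shape of `Π(ξ_v)` — members `{πⁿ(ξ_v)} ∪ πˢ(ξ_v)`, `⟨1, πⁿ⟩ = 1`, `⟨1, πˢ⟩ = −1` — are EQUAL under token extensionality (KM1) and junk-normalisation (KJ-G);
   an A-token MEETING `Π(ξ_v)` carries that shape by (KM3) [p. 199: distinct A-packets are disjoint; §13.2 p. 200 l. 1–3]; a non-A token never contains `πⁿ(ξ_v)` by (KM2) [p. 199 ¶2].
2. ONE GOOD PLACE (hypothesis `hL` of §3, print + Satake): an all-L `Q` with `t(Q) = t(ξ)` off `S` has, at any `v ∉ S`, unramified member with the eigencharacter of `πⁿ(ξ_v)`, hence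
   `= πⁿ(ξ_v)` [CartierCorvallis1979 §IV.1 Cor. 4.1 — ★ `IrrClass.eq_of_eigencharacter_eq`] — so `πⁿ(ξ_v) ∈ Q_v`, contradicting (KM2).  Kept as the named hypothesis «∃ v, πⁿ(ξ_v) ∈ Q_v».
3. EVERY PLACE (hypothesis `hA` of §3 = Thm. 13.3.6 (c) + layer 2): an all-A `Q` with `t(Q) = t(ξ)` off `S` meets `Π(ξ_v)` at EVERY `v` (off `S` by layer 2; on `S` because its discrete
   member `π′` has `π′_v ≅ πⁿ(ξ_v)` at a non-split place, so `π′ ∈ Π(ξ)` by Thm. 13.3.6 (c), i.e. `π′_v ∈ Π(ξ_v)` for all `v`).  Kept as the named hypothesis «∀ v, `Q_v` meets `Π(ξ_v)`».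
Given 2 and 3, (L1″) follows from the four marker rows of `TupleKitLaws` ALONE (§3 `xiRigidityGHom_of_marker_laws`) — the rows (KM1)(KJ-G)(KM2)(KM3) that T-B `k9stfS_of_tuple` leaves
unread are exactly what rigidity-G consumes (census ec8ac256 §5 (1)).  The hypotheses are stated with an abstract family `Pk ξ v` (the letter instantiates `Pk := transportAPackets 𝔨.ψ Pk′`,
so `hKM1`∕`hKJ`∕`hKM2`∕`hKM3` below are the T-A :320∕:302∕:322∕:324 rows token for token).

CONTENTS:
* §1 `GlobalPacket.eq_of_loc_eq`, `SpectralPacketG.eq_of_fin_eq_of_inf_eq`, `SpectralPacketG.eq_of_coherent_of_loc_eq`, `SpectralPacketG.eq_piXiHm_of_loc_eq`.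
* §2 `LocalPacketKit.eq_of_xiShape` (two marked tokens with the ξ-shape are equal under (KM1)+(KJ-G) at `v`), `LocalPacketKit.eq_of_meet` (the same from «meets» under (KM3)),
  `LocalPacketKit.not_mem_of_not_aTok` ((KM2) read contrapositively).
* §3 `SpectralPacketG.eq_piXiHm_of_allA_of_meet`, `SpectralPacketG.false_of_allL_of_mem`, `SpectralPacketG.xiRigidityGHom_of_cases` (all-A: placewise token equality; all-L: absurd),
  **`SpectralPacketG.xiRigidityGHom_of_marker_laws`** ((L1″) from (KM1)(KJ-G)(KM2)(KM3) + `hL` + `hA`).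
No instance, no notation, no named fact, no `sorry`.
HONEST LABEL: HC_CM is proved only modulo the 7 printed citations (2 remaining: hLiu418 = stmt-HodgeConjecture-24832, h413 = stmt-HodgeConjecture-24833) until rung 0 closes;
this file proves no printed statement — it reduces the rigidity conjunct of (PK-A-G) to kit laws plus two named member facts (print: Thm. 13.3.6 (c), Satake injectivity).

References: [Rogawski1990] §13.3 Thm. 13.3.5 p. 202, Thm. 13.3.6 (c) p. 202, p. 201 ll. 16–18, p. 199 ¶2 and l. −2; §13.2 p. 200 l. 1–3; §13.1 Prop. 13.1.3 (d) p. 199; §13.7 p. 206;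
§14.6 (14.6.2) p. 241.  [CartierCorvallis1979] §IV.1 Cor. 4.1.
-/

set_option autoImplicit false
-- the mandated namespace repeats `HodgeConjecture.HodgeConjecture`, as in every `Theorems/*.lean` of this sub-problem
set_option linter.dupNamespace false

noncomputable section

open NumberField IsDedekindDomain MeasureTheory
open scoped Matrix MatrixGroups

open Literature.NumberTheory Literature.NumberTheory.Automorphic Literature.NumberTheory.Automorphic.UnitaryGroup
open Literature.NumberTheory.Rogawski1990 Literature.NumberTheory.GaloisRepresentations
open Literature.RepresentationTheory.BorelWallach2000 Literature.RepresentationTheory.KonnoKonno2007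
open Summit.HodgeConjecture.HodgeConjecture.Cruxes.H413.F0P3InnerFormClassificationV6 (splitForm EvpData EqOff)
open Summit.HodgeConjecture.HodgeConjecture.Cruxes.H413.F0P3LocalPacketKit
open Summit.HodgeConjecture.HodgeConjecture.Cruxes.H413.F0P3ArchPacketKit

/-! ## §1 Extensionality: a coherent spectral packet is its finite tokens [Thm. 13.3.5] -/

namespace Summit.HodgeConjecture.HodgeConjecture.Cruxes.H413.F0P3GlobalPacket.GlobalPacket

variable {L : Type} [Field L] [NumberField L] [IsCMField L] {H' : Matrix (Fin 3) (Fin 3) L}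
  {𝔩 : ∀ v : HeightOneSpectrum (𝓞 ↥(maximalRealSubfield L)), LocalPacketKit L H' v}

/-- **Extensionality of `GlobalPacket`**: a finite-place packet is its tokens `(Π_v)_v` (the clause `cofinite_unr` is a proposition about them). [cite: Rogawski1990, §13.3 p. 203 ¶2, Thm. 13.3.5 p. 202] -/
theorem eq_of_loc_eq {Pg Pg' : GlobalPacket 𝔩} (h : ∀ v, Pg.loc v = Pg'.loc v) : Pg = Pg' := by
  cases Pg with
  | mk loc hloc =>
    cases Pg' with
    | mk loc' hloc' =>
      have : loc = loc' := funext h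
      subst this
      rfl

/-- `Π = Π′ ↔ Π_v = Π′_v` for all `v`. [cite: Rogawski1990, §13.3 Thm. 13.3.5 p. 202] -/
theorem eq_iff_forall_loc_eq (Pg Pg' : GlobalPacket 𝔩) : Pg = Pg' ↔ ∀ v, Pg.loc v = Pg'.loc v :=
  ⟨fun h _ => h ▸ rfl, eq_of_loc_eq⟩

end Summit.HodgeConjecture.HodgeConjecture.Cruxes.H413.F0P3GlobalPacket.GlobalPacket

namespace Summit.HodgeConjecture.HodgeConjecture.Cruxes.H413.F0P3SpectralPacket.SpectralPacketG

open Summit.HodgeConjecture.HodgeConjecture.Cruxes.H413.F0P3GlobalPacket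

section Ext

variable {L : Type} [Field L] [NumberField L] [IsCMField L] {H' : Matrix (Fin 3) (Fin 3) L}
  {𝔩 : ∀ v : HeightOneSpectrum (𝓞 ↥(maximalRealSubfield L)), LocalPacketKit L H' v} {𝔞 : ArchPacketKit}
  {μ : Measure (adelicGroupData (↥(maximalRealSubfield L)) L (IsCMField.complexConj L) 3 H').automorphicQuotient}
  [SMulInvariantMeasure (adelicGroupData (↥(maximalRealSubfield L)) L (IsCMField.complexConj L) 3 H').Adelic
    (adelicGroupData (↥(maximalRealSubfield L)) L (IsCMField.complexConj L) 3 H').automorphicQuotient μ]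

/-- **Extensionality of `SpectralPacketG`**: a discrete packet is its finite part and its archimedean packet (`isDiscrete` is a proposition). [cite: Rogawski1990, §13.3 Thm. 13.3.5 p. 202] -/
theorem eq_of_fin_eq_of_inf_eq {Q Q' : SpectralPacketG 𝔩 𝔞 μ} (hf : Q.fin = Q'.fin) (hi : Q.inf = Q'.inf) : Q = Q' := by
  cases Q with
  | mk fin inf hd =>
    cases Q' with
    | mk fin' inf' hd' =>
      simp only at hf hi
      subst hf
      subst hi
      rfl

/-- **A COHERENT packet is its finite tokens**: if `Q.inf = infOf Q.fin` and `Q′.inf = infOf Q′.fin` (★ 3v∕3w coherence, Thm. 13.3.5) and `Q_v = Q′_v` at every finite place, then `Q = Q′`.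
[cite: Rogawski1990, §13.3 Thm. 13.3.5 p. 202] -/
theorem eq_of_coherent_of_loc_eq {infOf : GlobalPacket 𝔩 → 𝔞.PktInf} {Q Q' : SpectralPacketG 𝔩 𝔞 μ} (hQ : Q.inf = infOf Q.fin) (hQ' : Q'.inf = infOf Q'.fin)
    (h : ∀ v, Q.fin.loc v = Q'.fin.loc v) : Q = Q' := by
  have hf : Q.fin = Q'.fin := GlobalPacket.eq_of_loc_eq h
  exact eq_of_fin_eq_of_inf_eq hf (by rw [hQ, hQ', hf])

variable {infOf : GlobalPacket 𝔩 → 𝔞.PktInf} {aTok : ∀ v : HeightOneSpectrum (𝓞 ↥(maximalRealSubfield L)), Set (𝔩 v).Pkt}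
  {PkX : OneDimAutRepH L → ∀ v : HeightOneSpectrum (𝓞 ↥(maximalRealSubfield L)), CMLocalAPacket L H' v}
  {PkInfX : OneDimAutRepH L → LocalAPacket (GKIrrClass (uFormGroup (Fin 2) (Fin 1)))} {κX : OneDimAutRepH L → ℤ}

/-- **`Q = Π(ξ)` from coherence and placewise token equality** (the shape in which (L1″) is discharged). [cite: Rogawski1990, §13.3 Thm. 13.3.5 p. 202] -/
theorem eq_piXiHm_of_loc_eq (h : XiPacketsSignedHom 𝔩 𝔞 μ infOf aTok PkX PkInfX κX) (ξ : OneDimAutRepH L) {Q : SpectralPacketG 𝔩 𝔞 μ} (hcoh : Q.inf = infOf Q.fin)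
    (hloc : ∀ v, Q.fin.loc v = (piXiHm h ξ).1.fin.loc v) : Q = (piXiHm h ξ).1 :=
  eq_of_coherent_of_loc_eq hcoh (piXiHm_inf_eq h ξ) hloc

end Ext

end Summit.HodgeConjecture.HodgeConjecture.Cruxes.H413.F0P3SpectralPacket.SpectralPacketG

/-! ## §2 One place: marked tokens with the ξ-shape are equal under (KM1)+(KJ-G); (KM3) supplies the shape; (KM2) excludes `πⁿ(ξ_v)` from non-A tokens [p. 199; §13.2 p. 200 l. 1–3] -/

namespace Summit.HodgeConjecture.HodgeConjecture.Cruxes.H413.F0P3LocalPacketKit.LocalPacketKit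

variable {L : Type} [Field L] [NumberField L] [IsCMField L] {H' : Matrix (Fin 3) (Fin 3) L} {v : HeightOneSpectrum (𝓞 ↥(maximalRealSubfield L))}

/-- **TWO MARKED TOKENS WITH THE SIGNED ξ-SHAPE ARE EQUAL** under token extensionality (KM1) and junk-normalisation (KJ-G) at `v`: both have members `{πⁿ} ∪ πˢ` of the datum `x`,
`⟨1, πⁿ⟩ = 1`, `⟨1, c⟩ = −1` on the other members, hence the same `mem`, the same total `one` (junk `0` off members) and the same marking.
[cite: Rogawski1990, §13.1 p. 199; §13.2 p. 200 l. 1–3] -/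
theorem eq_of_xiShape (𝔩 : LocalPacketKit L H' v) (aTokv : Set 𝔩.Pkt)
    (hKM1 : ∀ P P' : 𝔩.Pkt, 𝔩.mem P = 𝔩.mem P' → (∀ c, 𝔩.one P c = 𝔩.one P' c) → (P ∈ aTokv ↔ P' ∈ aTokv) → P = P')
    (hKJ : ∀ (P : 𝔩.Pkt) (c : IrrClass ((UnitaryGroup.cmDatum L 3 H').Local v)), c ∉ 𝔩.mem P → 𝔩.one P c = 0)
    (x : CMLocalAPacket L H' v) {P P' : 𝔩.Pkt} (hP : P ∈ aTokv) (hP' : P' ∈ aTokv)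
    (hmem : ∀ c, c ∈ 𝔩.mem P ↔ (c = x.πn ∨ x.πs = some c)) (h1 : 𝔩.one P x.πn = 1) (hs : ∀ c ∈ 𝔩.mem P, c ≠ x.πn → 𝔩.one P c = -1)
    (hmem' : ∀ c, c ∈ 𝔩.mem P' ↔ (c = x.πn ∨ x.πs = some c)) (h1' : 𝔩.one P' x.πn = 1) (hs' : ∀ c ∈ 𝔩.mem P', c ≠ x.πn → 𝔩.one P' c = -1) :
    P = P' := by
  have hm : 𝔩.mem P = 𝔩.mem P' := Finset.ext fun c => (hmem c).trans (hmem' c).symm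
  refine hKM1 P P' hm (fun c => ?_) ⟨fun _ => hP', fun _ => hP⟩
  by_cases hc : c ∈ 𝔩.mem P
  · have hc' : c ∈ 𝔩.mem P' := hm ▸ hc
    by_cases hcn : c = x.πn
    · rw [hcn, h1, h1']
    · rw [hs c hc hcn, hs' c hc' hcn]
  · have hc' : c ∉ 𝔩.mem P' := hm ▸ hc
    rw [hKJ P c hc, hKJ P' c hc']

/-- **TWO A-TOKENS MEETING `Π(ξ_v)` ARE EQUAL** under (KM1)+(KJ-G)+(KM3) at `v` («an A-token meeting `Π(ξ_v)` IS the signed `Π(ξ_v)`», [p. 199 «at most one packet unless `π = πˢ(ξ)`»;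
§13.2 p. 200 l. 1–3]). [cite: Rogawski1990, §13.1 p. 199; §13.2 p. 200 l. 1–3] -/
theorem eq_of_meet (𝔩 : LocalPacketKit L H' v) (aTokv : Set 𝔩.Pkt)
    (hKM1 : ∀ P P' : 𝔩.Pkt, 𝔩.mem P = 𝔩.mem P' → (∀ c, 𝔩.one P c = 𝔩.one P' c) → (P ∈ aTokv ↔ P' ∈ aTokv) → P = P')
    (hKJ : ∀ (P : 𝔩.Pkt) (c : IrrClass ((UnitaryGroup.cmDatum L 3 H').Local v)), c ∉ 𝔩.mem P → 𝔩.one P c = 0)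
    (x : CMLocalAPacket L H' v)
    (hKM3 : ∀ P : 𝔩.Pkt, P ∈ aTokv → (x.πn ∈ 𝔩.mem P ∨ ∃ c, x.πs = some c ∧ c ∈ 𝔩.mem P) →
      (∀ c, c ∈ 𝔩.mem P ↔ (c = x.πn ∨ x.πs = some c)) ∧ 𝔩.one P x.πn = 1 ∧ ∀ c ∈ 𝔩.mem P, c ≠ x.πn → 𝔩.one P c = -1)
    {P P' : 𝔩.Pkt} (hP : P ∈ aTokv) (hP' : P' ∈ aTokv)
    (hmeet : x.πn ∈ 𝔩.mem P ∨ ∃ c, x.πs = some c ∧ c ∈ 𝔩.mem P) (hmeet' : x.πn ∈ 𝔩.mem P' ∨ ∃ c, x.πs = some c ∧ c ∈ 𝔩.mem P') : P = P' := by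
  obtain ⟨hmem, h1, hs⟩ := hKM3 P hP hmeet
  obtain ⟨hmem', h1', hs'⟩ := hKM3 P' hP' hmeet'
  exact 𝔩.eq_of_xiShape aTokv hKM1 hKJ x hP hP' hmem h1 hs hmem' h1' hs'

/-- **(KM2) read contrapositively**: a token containing `πⁿ(ξ_v)` is an A-token [p. 199 ¶2: `πⁿ(ξ_v)` lies in no L-packet]. [cite: Rogawski1990, §13.1 p. 199 ¶2] -/
theorem mem_aTok_of_mem (𝔩 : LocalPacketKit L H' v) (aTokv : Set 𝔩.Pkt) (x : CMLocalAPacket L H' v)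
    (hKM2 : ∀ P : 𝔩.Pkt, P ∉ aTokv → x.πn ∉ 𝔩.mem P) {P : 𝔩.Pkt} (hmem : x.πn ∈ 𝔩.mem P) : P ∈ aTokv := by
  by_contra hP
  exact hKM2 P hP hmem

end Summit.HodgeConjecture.HodgeConjecture.Cruxes.H413.F0P3LocalPacketKit.LocalPacketKit

/-! ## §3 (L1″) from the marker laws and the two member facts [Thm. 13.3.5, Thm. 13.3.6 (c); p. 199 ¶2] -/

namespace Summit.HodgeConjecture.HodgeConjecture.Cruxes.H413.F0P3SpectralPacket.SpectralPacketG

open Summit.HodgeConjecture.HodgeConjecture.Cruxes.H413.F0P3GlobalPacket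

section Shape

variable {L : Type} [Field L] [NumberField L] [IsCMField L] {H' : Matrix (Fin 3) (Fin 3) L}
  {𝔩 : ∀ v : HeightOneSpectrum (𝓞 ↥(maximalRealSubfield L)), LocalPacketKit L H' v} {𝔞 : ArchPacketKit}
  {μ : Measure (adelicGroupData (↥(maximalRealSubfield L)) L (IsCMField.complexConj L) 3 H').automorphicQuotient}
  [SMulInvariantMeasure (adelicGroupData (↥(maximalRealSubfield L)) L (IsCMField.complexConj L) 3 H').Adelic
    (adelicGroupData (↥(maximalRealSubfield L)) L (IsCMField.complexConj L) 3 H').automorphicQuotient μ]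
  {infOf : GlobalPacket 𝔩 → 𝔞.PktInf} {aTok : ∀ v : HeightOneSpectrum (𝓞 ↥(maximalRealSubfield L)), Set (𝔩 v).Pkt}
  {PkX : OneDimAutRepH L → ∀ v : HeightOneSpectrum (𝓞 ↥(maximalRealSubfield L)), CMLocalAPacket L H' v}
  {PkInfX : OneDimAutRepH L → LocalAPacket (GKIrrClass (uFormGroup (Fin 2) (Fin 1)))} {κX : OneDimAutRepH L → ℤ}

/-- **ALL-A CASE**: a coherent discrete packet all of whose tokens are A-tokens MEETING `Π(ξ_v)` at every place IS `Π(ξ)`, under (KM1)+(KJ-G)+(KM3) (the tokens of `Π(ξ) = (piXiHm h ξ).1` are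
A-tokens with the signed ξ-shape by ★ 3w `piXiHm_mem_aTok` ∕ `piXiHm_isSignedPacketOf`). [cite: Rogawski1990, §13.3 Thm. 13.3.5 p. 202, Thm. 13.3.6 (c) p. 202; §13.1 p. 199; §13.2 p. 200 l. 1–3] -/
theorem eq_piXiHm_of_allA_of_meet
    (hKM1 : ∀ (v : HeightOneSpectrum (𝓞 ↥(maximalRealSubfield L))) (P P' : (𝔩 v).Pkt), (𝔩 v).mem P = (𝔩 v).mem P' → (∀ c, (𝔩 v).one P c = (𝔩 v).one P' c) →
      (P ∈ aTok v ↔ P' ∈ aTok v) → P = P')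
    (hKJ : ∀ (v : HeightOneSpectrum (𝓞 ↥(maximalRealSubfield L))) (P : (𝔩 v).Pkt) (c : IrrClass ((UnitaryGroup.cmDatum L 3 H').Local v)), c ∉ (𝔩 v).mem P → (𝔩 v).one P c = 0)
    (hKM3 : ∀ (ξ : OneDimAutRepH L) (v : HeightOneSpectrum (𝓞 ↥(maximalRealSubfield L))) (P : (𝔩 v).Pkt), P ∈ aTok v →
      ((PkX ξ v).πn ∈ (𝔩 v).mem P ∨ ∃ c, (PkX ξ v).πs = some c ∧ c ∈ (𝔩 v).mem P) →
      (∀ c, c ∈ (𝔩 v).mem P ↔ (c = (PkX ξ v).πn ∨ (PkX ξ v).πs = some c)) ∧ (𝔩 v).one P (PkX ξ v).πn = 1 ∧ ∀ c ∈ (𝔩 v).mem P, c ≠ (PkX ξ v).πn → (𝔩 v).one P c = -1)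
    (h : XiPacketsSignedHom 𝔩 𝔞 μ infOf aTok PkX PkInfX κX) (ξ : OneDimAutRepH L) {Q : SpectralPacketG 𝔩 𝔞 μ} (hcoh : Q.inf = infOf Q.fin)
    (hA : ∀ v, Q.fin.loc v ∈ aTok v)
    (hmeet : ∀ v, (PkX ξ v).πn ∈ (𝔩 v).mem (Q.fin.loc v) ∨ ∃ c, (PkX ξ v).πs = some c ∧ c ∈ (𝔩 v).mem (Q.fin.loc v)) :
    Q = (piXiHm h ξ).1 := by
  refine eq_piXiHm_of_loc_eq h ξ hcoh fun v => ?_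
  have hsh := piXiHm_isSignedPacketOf h ξ
  exact (𝔩 v).eq_of_meet (aTok v) (hKM1 v) (hKJ v) (PkX ξ v) (hKM3 ξ v) (hA v) (piXiHm_mem_aTok h ξ v) (hmeet v)
    (Or.inl (((hsh.mem_fin_iff v _).2 (Or.inl rfl))))

/-- **ALL-L CASE**: a packet none of whose tokens is an A-token cannot contain `πⁿ(ξ_v)` anywhere, by (KM2) [p. 199 ¶2]. [cite: Rogawski1990, §13.1 p. 199 ¶2] -/
theorem false_of_allL_of_mem
    (hKM2 : ∀ (ξ : OneDimAutRepH L) (v : HeightOneSpectrum (𝓞 ↥(maximalRealSubfield L))) (P : (𝔩 v).Pkt), P ∉ aTok v → (PkX ξ v).πn ∉ (𝔩 v).mem P)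
    (ξ : OneDimAutRepH L) {Q : SpectralPacketG 𝔩 𝔞 μ} (hL : ∀ v, Q.fin.loc v ∉ aTok v)
    {v : HeightOneSpectrum (𝓞 ↥(maximalRealSubfield L))} (hmem : (PkX ξ v).πn ∈ (𝔩 v).mem (Q.fin.loc v)) : False :=
  hKM2 ξ v (Q.fin.loc v) (hL v) hmem

end Shape

section Rigidity

variable {L : Type} [Field L] [NumberField L] [IsCMField L] {H : Matrix (Fin 3) (Fin 3) L}
  {𝔩 : ∀ v : HeightOneSpectrum (𝓞 ↥(maximalRealSubfield L)), LocalPacketKit L (splitForm L 3) v} {𝔞 : ArchPacketKit}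
  {μ : Measure (adelicGroupData (↥(maximalRealSubfield L)) L (IsCMField.complexConj L) 3 (splitForm L 3)).automorphicQuotient}
  [SMulInvariantMeasure (adelicGroupData (↥(maximalRealSubfield L)) L (IsCMField.complexConj L) 3 (splitForm L 3)).Adelic
    (adelicGroupData (↥(maximalRealSubfield L)) L (IsCMField.complexConj L) 3 (splitForm L 3)).automorphicQuotient μ]
  {infOf : GlobalPacket 𝔩 → 𝔞.PktInf} {aTok : ∀ v : HeightOneSpectrum (𝓞 ↥(maximalRealSubfield L)), Set (𝔩 v).Pkt}
  {Pk : OneDimAutRepH L → ∀ v : HeightOneSpectrum (𝓞 ↥(maximalRealSubfield L)), CMLocalAPacket L (splitForm L 3) v}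
  {PkInf : OneDimAutRepH L → LocalAPacket (GKIrrClass (uFormGroup (Fin 2) (Fin 1)))} {κ : OneDimAutRepH L → ℤ}
  {h : XiPacketsSignedHom 𝔩 𝔞 μ infOf aTok Pk PkInf κ}
  {ψ : ∀ v : HeightOneSpectrum (𝓞 ↥(maximalRealSubfield L)), (cmDatum L 3 H).Local v ≃ₜ* (cmDatum L 3 (splitForm L 3)).Local v}
  [∀ v : HeightOneSpectrum (𝓞 ↥(maximalRealSubfield L)), MeasurableSpace ((cmDatum L 3 (splitForm L 3)).Local v)]
  {νG : ∀ v : HeightOneSpectrum (𝓞 ↥(maximalRealSubfield L)), Measure ((cmDatum L 3 (splitForm L 3)).Local v)}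
  {tXi : OneDimAutRepH L → EvpData L H}

/-- **(L1″) BY CASES ON THE SORT**: rigidity holds as soon as (all-A) every coherent all-A packet with the ξ-germ has the tokens of `Π(ξ)` placewise, and (all-L) no coherent all-L packet has the
ξ-germ. [cite: Rogawski1990, §13.3 Thm. 13.3.5 p. 202, Thm. 13.3.6 (c) p. 202, p. 201 ll. 16–18] -/
theorem xiRigidityGHom_of_cases
    (hA : ∀ (ξ : OneDimAutRepH L) (S : Finset (HeightOneSpectrum (𝓞 ↥(maximalRealSubfield L)))) (Q : SpectralPacketG 𝔩 𝔞 μ),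
      Q.inf = infOf Q.fin → (∀ v, Q.fin.loc v ∈ aTok v) → EqOff L H S (Q.evpGψ ψ νG) (tXi ξ) → Q.fin.ramFinset ⊆ S → ∀ v, Q.fin.loc v = (piXiHm h ξ).1.fin.loc v)
    (hL : ∀ (ξ : OneDimAutRepH L) (S : Finset (HeightOneSpectrum (𝓞 ↥(maximalRealSubfield L)))) (Q : SpectralPacketG 𝔩 𝔞 μ),
      Q.inf = infOf Q.fin → (∀ v, Q.fin.loc v ∉ aTok v) → EqOff L H S (Q.evpGψ ψ νG) (tXi ξ) → Q.fin.ramFinset ⊆ S → False) :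
    XiRigidityGHom h ψ νG tXi := by
  intro ξ S Q hcoh hhom hevp hram
  rcases hhom with hall | hnone
  · exact eq_piXiHm_of_loc_eq h ξ hcoh (hA ξ S Q hcoh hall hevp hram)
  · exact (hL ξ S Q hcoh hnone hevp hram).elim

/-- **(L1″) `XiRigidityGHom` FROM THE MARKER LAWS (KM1)∕(KJ-G)∕(KM2)∕(KM3) AND THE TWO MEMBER FACTS** — `hL`: an all-L coherent packet with the ξ-germ off `S ⊇ ramG` contains `πⁿ(ξ_v)` at
SOME place (print: at any `v ∉ S`, Satake injectivity [CartierCorvallis1979 §IV.1 Cor. 4.1]); `hA`: an all-A coherent packet with the ξ-germ off `S ⊇ ramG` MEETS `Π(ξ_v)` at EVERY place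
(print: Thm. 13.3.6 (c) for its discrete member, + Satake off `S`).  Then every such all-L packet contradicts (KM2) and every such all-A packet is `Π(ξ)` token by token ((KM3), then
(KM1)+(KJ-G) against the tokens of `piXiHm h ξ`), and coherence finishes (§1). [cite: Rogawski1990, §13.3 Thm. 13.3.5 p. 202, Thm. 13.3.6 (c) p. 202, p. 199 ¶2; §13.2 p. 200 l. 1–3; §13.7 p. 206] -/
theorem xiRigidityGHom_of_marker_laws
    (hKM1 : ∀ (v : HeightOneSpectrum (𝓞 ↥(maximalRealSubfield L))) (P P' : (𝔩 v).Pkt), (𝔩 v).mem P = (𝔩 v).mem P' → (∀ c, (𝔩 v).one P c = (𝔩 v).one P' c) →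
      (P ∈ aTok v ↔ P' ∈ aTok v) → P = P')
    (hKJ : ∀ (v : HeightOneSpectrum (𝓞 ↥(maximalRealSubfield L))) (P : (𝔩 v).Pkt) (c : IrrClass ((UnitaryGroup.cmDatum L 3 (splitForm L 3)).Local v)),
      c ∉ (𝔩 v).mem P → (𝔩 v).one P c = 0)
    (hKM2 : ∀ (ξ : OneDimAutRepH L) (v : HeightOneSpectrum (𝓞 ↥(maximalRealSubfield L))) (P : (𝔩 v).Pkt), P ∉ aTok v → (Pk ξ v).πn ∉ (𝔩 v).mem P)
    (hKM3 : ∀ (ξ : OneDimAutRepH L) (v : HeightOneSpectrum (𝓞 ↥(maximalRealSubfield L))) (P : (𝔩 v).Pkt), P ∈ aTok v →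
      ((Pk ξ v).πn ∈ (𝔩 v).mem P ∨ ∃ c, (Pk ξ v).πs = some c ∧ c ∈ (𝔩 v).mem P) →
      (∀ c, c ∈ (𝔩 v).mem P ↔ (c = (Pk ξ v).πn ∨ (Pk ξ v).πs = some c)) ∧ (𝔩 v).one P (Pk ξ v).πn = 1 ∧ ∀ c ∈ (𝔩 v).mem P, c ≠ (Pk ξ v).πn → (𝔩 v).one P c = -1)
    (hL : ∀ (ξ : OneDimAutRepH L) (S : Finset (HeightOneSpectrum (𝓞 ↥(maximalRealSubfield L)))) (Q : SpectralPacketG 𝔩 𝔞 μ),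
      Q.inf = infOf Q.fin → (∀ v, Q.fin.loc v ∉ aTok v) → EqOff L H S (Q.evpGψ ψ νG) (tXi ξ) → Q.fin.ramFinset ⊆ S →
      ∃ v, (Pk ξ v).πn ∈ (𝔩 v).mem (Q.fin.loc v))
    (hA : ∀ (ξ : OneDimAutRepH L) (S : Finset (HeightOneSpectrum (𝓞 ↥(maximalRealSubfield L)))) (Q : SpectralPacketG 𝔩 𝔞 μ),
      Q.inf = infOf Q.fin → (∀ v, Q.fin.loc v ∈ aTok v) → EqOff L H S (Q.evpGψ ψ νG) (tXi ξ) → Q.fin.ramFinset ⊆ S →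
      ∀ v, (Pk ξ v).πn ∈ (𝔩 v).mem (Q.fin.loc v) ∨ ∃ c, (Pk ξ v).πs = some c ∧ c ∈ (𝔩 v).mem (Q.fin.loc v)) :
    XiRigidityGHom h ψ νG tXi := by
  intro ξ S Q hcoh hhom hevp hram
  rcases hhom with hall | hnone
  · exact eq_piXiHm_of_allA_of_meet hKM1 hKJ hKM3 h ξ hcoh hall (hA ξ S Q hcoh hall hevp hram)
  · obtain ⟨v, hv⟩ := hL ξ S Q hcoh hnone hevp hram
    exact (false_of_allL_of_mem hKM2 ξ hnone hv).elim

end Rigidity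

end Summit.HodgeConjecture.HodgeConjecture.Cruxes.H413.F0P3SpectralPacket.SpectralPacketG

end
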